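import Summits.BirchSwinnertonDyer.BirchSwinnertonDyer.Theses.QuadraticBranchSignedControl
import Summits.BirchSwinnertonDyer.BirchSwinnertonDyer.Theorems.QuadraticBranchSignedControlEtaTransportPlus
import Summits.BirchSwinnertonDyer.BirchSwinnertonDyer.Theorems.QuadraticBranchSignedControlEtaTransportPlusOfDecomposition
import Summits.BirchSwinnertonDyer.BirchSwinnertonDyer.Theorems.QuadraticBranchSignedControlPlusLowerInclusionUnitCoeffCertificates
import Summits.BirchSwinnertonDyer.Rank1Residual.Additive.QuadraticBranchPlusEtaNodes
import HarnessLib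

/-!
# Route `QuadraticBranchSignedControl` (rung K8, cell `bsd-potss`), crux `PlusEtaLowerInclusion`
# (item stmt-BirchSwinnertonDyer-19601): the RANK-UNIFORM VALUATION SQUEEZE — (E⁺_η) (indeed
# (C1⁺_η)) at a tower-onto pair of ANY Mordell–Weil rank from ONE divisibility of `p`-adic integers

WHAT. The crux 19601 is the Eisenstein inclusion `Char(X⁺(V/K_∞)^η) ⊆ (L_p⁺(V, η, X))` of
Kobayashi's even main conjecture at `η = ω^{(p−1)/2}` (node `QuadraticBranchPlusEtaLowerInclusionAt`,
print currency) on the tower-onto good supersingular `a_p = 0` twists `V` (`p ≥ 5`). The tree held the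
`λ`-SQUEEZE (k8q-c2 / k8eta-c1 g0: BOTH plus `p`-adic `L`-functions have a UNIT coefficient at the
Mordell–Weil rank; 4 of the 21 rank-one tower-onto census rows) and the rank-ZERO converse roads (ctrl g4
/ k8-rung / k8eta-c1 g2: lower `p`-part of BSD for the partner `W`; 18 of 19 rank-zero rows). THIS FILE
proves the road containing both, the FIRST one bearing on the 17 rank-one rows with a `λ`-defect
(`λ(L_p⁺(V,η)) − rank W ∈ {2,4,6,8}` on the census): with `r = rank V^{(p*)}(ℚ)` (= `rank W(ℚ)` for the
Gss2 partner) and ONE displayed integer `v`,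

  Kobayashi Thm. 1.2 / 1.3 / 2.2(η) / 4.1(η) (NAMED facts) + `ρ_{V,p^∞}` onto
  + the `V`-certificate `coeff_{rank V(ℚ)} L_p⁺(V,T) ∈ ℤ_p^×` (holds on all 21 rank-one census rows)
  + ANALYTIC certificate  `p^{v+1} ∤ coeff_r L_p⁺(V,η,T)`   (a finite `p`-adic computation per pair)
  + ALGEBRAIC input        `p^{v} ∣ coeff_r ξ` for every characteristic power series `ξ` of `X⁺(V/K_∞)^η`
  ⟹ (C1⁺_η)(V,p) and (E⁺_η)(V,p).
So AT A TOWER-ONTO PAIR THE CRUX IS EXACTLY ONE INEQUALITY `v_p(coeff_r ξ_η) ≥ v_p(coeff_r L_p⁺(V,η))`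
between the `r`-th (= leading: both series are divisible by `T^r`) coefficients of the algebraic and
the analytic side; `v = 0` is the `λ`-squeeze, `r = 0` the constant-term squeeze of the rank-zero roads
(`v_p(ξ_η(0)) = ord_p #X⁺(V/K_∞)^η_Γ ≥ ord_p #Sel_{p^∞}(W) ≥ v_p(L(W,1)/Ω_W)`). For `r = 1` the algebraic
input is `v_p` of the LINEAR coefficient of `Char X⁺(V/K_∞)^η` (Perrin-Riou–Schneider / B.D. Kim shape,
UNPRINTED at `η ≠ 1`: `#Ш(W)[p^∞]·Tam(W)·(plus `p`-adic height of a generator)/#W(ℚ)_tors²` — NOT used).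

Chain (every brick a landed tree theorem; new are §1–§2): §1 `Λ`-algebra in `ℤ_p⟦T⟧` (`T^r ∣ ξ ∣ L`,
`p^v ∣ coeff_r ξ`, `p^{v+1} ∤ coeff_r L` force `(ξ) = (L)`: `ξ = T^r b`, `L = T^r b c`, `coeff_r L =
b(0)c(0)`, so `c(0) ∈ ℤ_p^×`, `c ∈ Λ^×`); §2 the `η`-RANK BOUND `T^{rank V^{(p*)}(ℚ)} ∣ ξ_η` on a
tower-onto pair with the `V`-certificate (seat k8q-c3's PROVED decomposition frame `etaDecomposition`
gives a dual datum of `Sel⁺(V'/F_∞)`, `F = ℚ(√p*)`, on `X⁺(V/ℚ_∞) × X_η` — the construction of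
`etaTransportPlus_of_decomposition` (p418003) repeated verbatim —, so `Char X⁺(V'/F_∞) = (ξ_ℚ ξ_η)`
(`charIdeal_mul_of_shortExact_holds`); the signed rank bound over `F`
(`Kobayashi2003.SignedSelmerDualData.X_pow_mordellWeilRank_dvd_of_charIdeal_eq_span`) and
`rank V'(F) = rank V(ℚ) + rank V^{(p*)}(ℚ)` (`mordellWeilRank_model_eq_add`) give
`T^{rank V + r} ∣ ξ_ℚ ξ_η`; Thm. 1.2 + 1.3 (tower onto) + the `V`-certificate pin `ξ_ℚ = T^{rank V}·unit`;
cancel); Kato side at `η`: `ξ_η ∣ Lη` (`EtaSignedSelmerDualData.thm41_plus_of_facts`); §3 the road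
`quadraticBranchPlusEta{MainConjecture,LowerInclusion}At_of_namedFacts_of_certV_of_coeffDvd` (its case
`v = 0` IS k8eta-c1 g0's `λ`-squeeze road `…_of_namedFacts_of_unitCoeffCertificates` of
`…PlusEtaFramesDischarged.lean` — same hypotheses, `p ∤ coeff` ⟺ unit; not restated here).

HONEST FRAMING (cell `bsd-potss`, run/shared/lean/pub/bsd-potss/; FULL-BSD rank ≤ 1 programme,
HUMAN RULING D-0036/D-0074): TOOL THEOREMS ONLY. Every statement is CONDITIONAL on named Literature
facts in hypothesis position (Kobayashi 2003 Thm. 1.2 / 1.3 / 2.2(η) / 4.1(η): deep, not proved in the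
tree), on the per-pair `V`-certificate and analytic certificate (finite computations, NOT supplied here
for any pair — kit evidence per pair), and on the per-pair ALGEBRAIC input `p^v ∣ coeff_r ξ_η`, OPEN on
the rank-one rows (no leading-term formula for `X⁺(V/K_∞)^η` at `η ≠ 1` is in print: B.D. Kim 2013 /
Perrin-Riou treat `η = 1`; Delbourgo 1998/2002 the potentially ORDINARY additive case only). The crux 19601 (= Kato's lower inclusion for the additive
twist `V ⊗ χ_{p*}` on the `η`-component) is OPEN class-wide and is NOT closed; nothing is booked;
`BSD(W, p)` is claimed for no pair; BSD is not proved by any of this. No definition, no named fact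
minted, no `sorry`, axioms standard. Seat `bsd-potss-k8eta-c1` (prover), g3;
`--supports stmt-BirchSwinnertonDyer-19601`.

References: [Kobayashi2003] Thm. 1.2/1.3 (p. 2), Thm. 2.2 (p. 5), §3 (pp. 5–7), §4 + Thm. 4.1 (p. 8);
[GreenbergLNM1716] §1, §3 Lemma 3.1; [SilvermanAEC2009] Ex. 10.16; [Washington1997] §13.2;
[Delbourgo1998], [Delbourgo2002] (additive potentially ORDINARY only — why nothing is citable at `η`).
-/

set_option autoImplicit false
set_option linter.dupNamespace false
noncomputable section

open scoped Classical

open CongruenceSubgroup Field WeierstrassCurve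
open Literature.NumberTheory.EllipticCurves
open Literature.NumberTheory.EllipticCurves.ModularForms
open Literature.NumberTheory.GaloisRepresentations
open Summit.BirchSwinnertonDyer.Rank1Residual.Additive
open Summit.BirchSwinnertonDyer.BirchSwinnertonDyer.Theses.QuadraticBranchSignedControl

namespace Summit.BirchSwinnertonDyer.BirchSwinnertonDyer.Theorems

/-! ## §1 `Λ`-algebra: the valuation squeeze in `ℤ_p⟦T⟧` -/

section Algebra

variable {p : ℕ} [Fact p.Prime]

/-- In `ℤ_p`: if `p^v ∣ b` and `p^{v+1} ∤ b c`, then `c` is a unit (else `p ∣ c`). [folklore] -/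
theorem isUnit_of_pow_dvd_of_not_pow_succ_dvd_mul {v : ℕ} {b c : ℤ_[p]}
    (hb : (p : ℤ_[p]) ^ v ∣ b) (hbc : ¬ (p : ℤ_[p]) ^ (v + 1) ∣ b * c) : IsUnit c := by
  by_contra hc
  apply hbc
  have hpc : (p : ℤ_[p]) ∣ c := by
    rw [← PadicInt.norm_lt_one_iff_dvd]
    exact lt_of_le_of_ne (PadicInt.norm_le_one c) (fun h => hc (PadicInt.isUnit_iff.mpr h))
  rw [pow_succ]
  exact mul_dvd_mul hb hpc

/-- **The valuation squeeze.** In `Λ = ℤ_p⟦T⟧`: if `T^r ∣ ξ`, `ξ ∣ L`, `p^v` divides the `r`-th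
coefficient of `ξ` and `p^{v+1}` does NOT divide the `r`-th coefficient of `L`, then `(ξ) = (L)` as
ideals (write `ξ = T^r b`, `L = T^r b c`; the `r`-th coefficients are `b(0)` and `b(0)c(0)`, so `c(0)`
is a unit of `ℤ_p` and `c` a unit of `Λ`). The case `v = 0` is the `λ`-squeeze
(`exists_isUnit_eq_X_pow_mul_of_dvd_of_dvd_of_isUnit_coeff`); the case `r = 0` is the constant-term
squeeze of the rank-zero roads. [cite: Washington1997, §13.2 (Λ = ℤ_p⟦T⟧; units are the series with unit constant term)] -/
theorem span_singleton_eq_of_X_pow_dvd_of_dvd_of_pow_dvd_coeff {r v : ℕ} {ξ L : IwasawaAlgebra p}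
    (hXξ : (PowerSeries.X : IwasawaAlgebra p) ^ r ∣ ξ) (hξL : ξ ∣ L)
    (halg : (p : ℤ_[p]) ^ v ∣ PowerSeries.coeff r ξ)
    (han : ¬ (p : ℤ_[p]) ^ (v + 1) ∣ PowerSeries.coeff r L) :
    Ideal.span {ξ} = Ideal.span {L} := by
  obtain ⟨b, rfl⟩ := hXξ
  obtain ⟨c, rfl⟩ := hξL
  have hcoeffξ : PowerSeries.coeff r (PowerSeries.X ^ r * b) = PowerSeries.constantCoeff b := by
    have h := PowerSeries.coeff_mul_X_pow b r 0
    rw [zero_add] at h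
    rw [PowerSeries.X_pow_mul, h, PowerSeries.coeff_zero_eq_constantCoeff]
  have hcoeffL : PowerSeries.coeff r (PowerSeries.X ^ r * b * c) =
      PowerSeries.constantCoeff b * PowerSeries.constantCoeff c := by
    have h := PowerSeries.coeff_mul_X_pow (b * c) r 0
    rw [zero_add] at h
    rw [mul_assoc, PowerSeries.X_pow_mul, h, PowerSeries.coeff_zero_eq_constantCoeff, map_mul]
  rw [hcoeffξ] at halg
  rw [hcoeffL] at han
  have hc : IsUnit c :=
    PowerSeries.isUnit_iff_constantCoeff.mpr (isUnit_of_pow_dvd_of_not_pow_succ_dvd_mul halg han)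
  rw [Ideal.span_singleton_eq_span_singleton]
  exact ⟨hc.unit, by rw [IsUnit.unit_spec]⟩

/-- Cancellation in `Λ`: `T^{a+b} ∣ T^a · u · g` with `u` a unit forces `T^b ∣ g`. [folklore] -/
theorem X_pow_dvd_of_X_pow_add_dvd {a b : ℕ} {u g : IwasawaAlgebra p} (hu : IsUnit u)
    (h : (PowerSeries.X : IwasawaAlgebra p) ^ (a + b) ∣ PowerSeries.X ^ a * u * g) :
    (PowerSeries.X : IwasawaAlgebra p) ^ b ∣ g := by
  have hX0 : (PowerSeries.X : IwasawaAlgebra p) ^ a ≠ 0 := pow_ne_zero _ PowerSeries.X_ne_zero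
  rw [pow_add, mul_assoc] at h
  exact (hu.dvd_mul_left).mp ((mul_dvd_mul_iff_left hX0).mp h)

/-- A product of torsion `Λ`-modules is torsion. [folklore] -/
theorem isTorsion_prod {X₀ X₁ : Type*} [AddCommGroup X₀] [Module (IwasawaAlgebra p) X₀]
    [AddCommGroup X₁] [Module (IwasawaAlgebra p) X₁]
    (h₀ : Module.IsTorsion (IwasawaAlgebra p) X₀) (h₁ : Module.IsTorsion (IwasawaAlgebra p) X₁) :
    Module.IsTorsion (IwasawaAlgebra p) (X₀ × X₁) := by
  rintro ⟨x₀, x₁⟩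
  obtain ⟨a, ha⟩ := @h₀ x₀
  obtain ⟨b, hb⟩ := @h₁ x₁
  refine ⟨a * b, ?_⟩
  rw [Submonoid.smul_def] at ha hb ⊢
  rw [Submonoid.coe_mul, Prod.smul_mk, Prod.mk_eq_zero]
  refine ⟨?_, ?_⟩
  · rw [mul_comm, mul_smul, ha, smul_zero]
  · rw [mul_smul, hb, smul_zero]

end Algebra

/-! ## §2 The `η`-rank bound `T^{rank V^{(p*)}(ℚ)} ∣ ξ_η` on a tower-onto pair with the `V`-certificate -/

section Pair

variable {V : WeierstrassCurve ℚ} [V.IsElliptic] [V.IsGloballyMinimal] {p : ℕ} [Fact p.Prime]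

/-- **`η`-RANK BOUND.** On a tower-onto good `a_p = 0` pair `(V, p)`, `p ≥ 5`, carrying the
`V`-certificate (`coeff_{rank V(ℚ)} L_p⁺(V,T) ∈ ℤ_p^×` for some plus function of the newform `f`):
GRANTED Kobayashi's Thm. 1.2, Thm. 1.3 (`η = 1`) and Thm. 2.2 at `η` (NAMED facts, hypothesis position),
every characteristic power series `ξ_η` of every `η`-datum `X⁺(V/K₀ℚ_∞)^η` is divisible by
`T^{rank V^{(p*)}(ℚ)}` (module docstring, Chain §2: decomposition frame ⟹ `Char X⁺(V'/F_∞) = (ξ_ℚ ξ_η)`,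
signed rank bound over `F = ℚ(√p*)`, `rank V'(F) = rank V + rank V^{(p*)}`, `ξ_ℚ = T^{rank V}·unit` by
Thm. 1.3 + the certificate; cancel). CONDITIONAL on the displayed inputs; asserts nothing class-wide. [cite: Kobayashi2003, Thm. 1.2 and Thm. 1.3 (p. 2), Thm. 2.2 (p. 5), §4 (p. 8)]
[cite: GreenbergLNM1716, §1 p. 65 and §3 Lemma 3.1 (easy half of control)] [cite: SilvermanAEC2009, Exercise 10.16] -/
theorem X_pow_twistRank_dvd_etaCharGenerator_of_namedFacts_of_certV
    (h12 : Kobayashi2003.thm12_signedSelmerDual_finite_torsion)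
    (h13 : Kobayashi2003.thm41_signedCharIdeal_divisibility)
    (h22 : Kobayashi2003.thm22_etaSignedSelmerDual_finite_torsion)
    (hp5 : 5 ≤ p) (hgood : V.HasGoodReductionAtPrime p) (hap : V.frobeniusTrace p = 0)
    (hsurj : ∀ m : ℕ, V.HasSurjectiveModNGaloisRep (p ^ m : ℕ))
    (hcertV : ∀ {N : ℕ} [NeZero N] (f : CuspForm (Gamma0 N) 2), IsNewformOf V f →
      ∃ L : IwasawaAlgebra p, Kobayashi2003.IsSignedPAdicLFunction f p 1 L ∧
        IsUnit (PowerSeries.coeff V.mordellWeilRank L))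
    {N : ℕ} [NeZero N] {f : CuspForm (Gamma0 N) 2} (hf : IsNewformOf V f)
    (K₀ : Type) [Field K₀] [NumberField K₀] [IsCyclotomicExtension {p} ℚ K₀]
    [(galRange (K := ℚ) K₀).Normal] (ηq : absoluteGaloisGroup ℚ →* ℤˣ)
    (hηK : ∀ σ ∈ galRange (K := ℚ) K₀, ηq σ = 1) (hη1 : ηq ≠ 1)
    (κ : ZpExtension ℚ p) (γ : absoluteGaloisGroup ℚ) (hκ : κ.IsCyclotomic) (hγ : κ.IsTopGenerator γ)
    (hγK : γ ∈ galRange (K := ℚ) K₀) (hγc : IsCyclotomicVariable p γ)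
    (D : EtaSignedSelmerDualData V κ K₀ ℚ_[p] ηq γ 1) {g : IwasawaAlgebra p}
    (hg : D.charIdeal = Ideal.span {g}) :
    (PowerSeries.X : IwasawaAlgebra p) ^ (V.quadraticTwist ((-1) ^ (p / 2) * p)).mordellWeilRank ∣ g := by
  have hp2 : p ≠ 2 := by omega
  obtain ⟨F, _instF, _instNF, V', _instE, κF, γF, Φ, hF2, hθ, hCV, hκF, hγF, hζ, hΦ⟩ :=
    etaDecomposition p hp5 K₀ ηq hηK hη1 V hgood hap κ γ hκ hγ hγK hγc
  -- Kobayashi's dual datum of `Sel⁺(V/ℚ_∞)` at `γ` (EXISTS), finitely generated torsion by Thm. 1.2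
  let D₀ : Kobayashi2003.SignedSelmerDualData V κ γ 1 := Kobayashi2003.signedSelmerDualData V κ 1 hγ
  obtain ⟨h0fin, h0tor⟩ := h12 V p hp2 hgood hap κ γ hκ hγ 1 D₀
  haveI : Module.Finite (IwasawaAlgebra p) D₀.X := h0fin
  -- the `η`-datum is finitely generated torsion by Thm. 2.2 at `η`
  obtain ⟨hfin, htor⟩ :=
    EtaSignedSelmerDualData.finite_isTorsion_of_thm22 h22 hηK hp2 hgood hap hκ hγ hγK D
  haveI : Module.Finite (IwasawaAlgebra p) D.X := hfin
  -- the two projections of the decomposition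
  let π₀ : Kobayashi2003.signedSelmerInfty V' κF 1 →+ Kobayashi2003.signedSelmerInfty V κ 1 :=
    (AddMonoidHom.fst _ _).comp Φ.toAddMonoidHom
  let π₁ : Kobayashi2003.signedSelmerInfty V' κF 1 →+ towerSignedSelmerInftyEta V κ K₀ ℚ_[p] ηq 1 :=
    (AddMonoidHom.snd _ _).comp Φ.toAddMonoidHom
  -- the character group of the direct sum (verbatim from `etaTransportPlus_of_decomposition`)
  let T : D₀.X × D.X →+ (Kobayashi2003.signedSelmerInfty V' κF 1 →+ AddCircle (1 : ℚ)) :=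
    AddMonoidHom.mk' (fun x => (D₀.toDual x.1).comp π₀ + (D.toDual x.2).comp π₁) (by
      intro x y
      simp only [Prod.fst_add, Prod.snd_add, map_add, AddMonoidHom.add_comp]
      abel)
  have hT : ∀ (x : D₀.X × D.X) (s : Kobayashi2003.signedSelmerInfty V' κF 1),
      T x s = D₀.toDual x.1 (Φ s).1 + D.toDual x.2 (Φ s).2 := fun x s => rfl
  have hTbij : Function.Bijective T :=
    bijective_dualOfProd Φ D₀.toDual D.toDual D₀.bijective D.bijective
  -- the dual datum of `Sel⁺(V'/F_∞)` on the module `D₀.X × D.X`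
  let DF : Kobayashi2003.SignedSelmerDualData V' κF γF 1 :=
    { X := D₀.X × D.X
      conj_mem := fun s hs => Kobayashi2003.conjH1_mem_signedSelmerInfty V' κF 1 γF hs
      toDual := T
      bijective := hTbij
      toDual_T_smul := by
        intro x s
        have h0 : (Φ ⟨V'.conjH1 p κF.kerSubgroup γF s,
            Kobayashi2003.conjH1_mem_signedSelmerInfty V' κF 1 γF s.2⟩).1 =
            ⟨V.conjH1 p κ.kerSubgroup γ (Φ s).1, D₀.conj_mem _ (Φ s).1.2⟩ :=
          Subtype.ext (hΦ s).1
        have h1 : (Φ ⟨V'.conjH1 p κF.kerSubgroup γF s,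
            Kobayashi2003.conjH1_mem_signedSelmerInfty V' κF 1 γF s.2⟩).2 =
            ⟨V.conjH1 p (towerTopSubgroup κ K₀) γ (Φ s).2, D.conj_mem _ (Φ s).2.2⟩ :=
          Subtype.ext (hΦ s).2
        rw [hT, hT, hT, Prod.smul_fst, Prod.smul_snd, D₀.toDual_T_smul, D.toDual_T_smul, h0, h1]
        abel
      toDual_C_smul := by
        intro c x s k hk
        have hk' : (p ^ k) • Φ s = 0 := by rw [← map_nsmul, hk, map_zero]
        have hk0 : (p ^ k) • (Φ s).1 = 0 := by
          have := congrArg Prod.fst hk'; simpa using this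
        have hk1 : (p ^ k) • (Φ s).2 = 0 := by
          have := congrArg Prod.snd hk'; simpa using this
        rw [hT, hT, Prod.smul_fst, Prod.smul_snd, D₀.toDual_C_smul c x.1 _ k hk0,
          D.toDual_C_smul c x.2 _ k hk1, smul_add] }
  haveI hFfin : Module.Finite (IwasawaAlgebra p) DF.X :=
    inferInstanceAs (Module.Finite (IwasawaAlgebra p) (D₀.X × D.X))
  have hFtor : Module.IsTorsion (IwasawaAlgebra p) DF.X := isTorsion_prod h0tor htor
  -- `Char X⁺(V'/F_∞) = Char X⁺(V/ℚ_∞) · Char X_η = (ξ · g)`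
  obtain ⟨ξ, hξ⟩ := (charIdeal_isPrincipal_holds p D₀.X).principal
  have hξ' : D₀.charIdeal = Ideal.span {ξ} := hξ
  have hmul : DF.charIdeal = D₀.charIdeal * D.charIdeal :=
    charIdeal_mul_of_shortExact_holds p (D₀.X × D.X) hFtor (LinearMap.inl (IwasawaAlgebra p) D₀.X D.X)
      (LinearMap.snd (IwasawaAlgebra p) D₀.X D.X) LinearMap.inl_injective LinearMap.snd_surjective
      .inl_snd
  have hcharF : DF.charIdeal = Ideal.span {ξ * g} := by
    rw [hmul, hξ', hg, Ideal.span_singleton_mul_span_singleton]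
  -- the signed rank bound over `F`, and the rank of `V'(F)`
  have hFdvd : (PowerSeries.X : IwasawaAlgebra p) ^ V'.mordellWeilRank ∣ ξ * g :=
    DF.X_pow_mordellWeilRank_dvd_of_charIdeal_eq_span hγF hFtor hcharF
  rw [mordellWeilRank_model_eq_add V F V' hF2 hθ hCV] at hFdvd
  -- the `V`-side: `T^{rank V(ℚ)} ∣ ξ ∣ L_p⁺(V)` (Thm. 1.3, tower onto) and the certificate pin `ξ ~ T^{rank V}`
  have hξdvd : (PowerSeries.X : IwasawaAlgebra p) ^ V.mordellWeilRank ∣ ξ :=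
    D₀.X_pow_mordellWeilRank_dvd_of_charIdeal_eq_span hγ h0tor hξ'
  obtain ⟨Lp, hLp, hcoefV⟩ := hcertV f hf
  have hLpmem : Lp ∈ D₀.charIdeal :=
    (h13 V p hp2 hgood hap f hf κ γ hκ hγ hγc 1 Lp hLp D₀ h0tor).2 hsurj
  have hξLp : ξ ∣ Lp := by
    rw [hξ'] at hLpmem
    exact Ideal.mem_span_singleton.mp hLpmem
  obtain ⟨a, ha, hξa⟩ := exists_isUnit_eq_X_pow_mul_of_dvd_of_dvd_of_isUnit_coeff hξdvd hξLp hcoefV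
  rw [hξa] at hFdvd
  exact X_pow_dvd_of_X_pow_add_dvd ha hFdvd

/-! ## §3 The road: (C1⁺_η) and (E⁺_η) at a tower-onto pair from ONE coefficient divisibility -/

/-- **(C1⁺_η) AT A TOWER-ONTO PAIR OF ANY RANK — the valuation squeeze.** Hypotheses: Kobayashi's
Thm. 1.2 (`h12`), Thm. 1.3 = 4.1 at `η = 1` (`h13`), Thm. 2.2 at `η` (`h22`), Thm. 4.1 at `η` (`h41`)
as NAMED facts; `p ≥ 5`, `V` good at `p` with `a_p = 0`, `ρ_{V,p^m}` onto for all `m`; the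
`V`-certificate `hcertV` (`coeff_{rank V(ℚ)} L_p⁺(V,T) ∈ ℤ_p^×`); ONE integer `v` with the ANALYTIC
certificate `han` (`p^{v+1} ∤ coeff_r L_p⁺(V,η,T)` for every branch function — they differ by units —
where `r = rank V^{(p*)}(ℚ)`; a finite `p`-adic computation per pair) and the ALGEBRAIC input `halg`
(`p^v ∣ coeff_r ξ_η` for every characteristic power series `ξ_η` of every `η`-datum). Conclusion:
`QuadraticBranchPlusEtaMainConjectureAt V p` at THIS pair (`ξ_η ∣ Lη` by Thm. 4.1 at `η`, `n = 0`;
`T^r ∣ ξ_η` by §2; §1). The rank-one rows of crux 19601 are thereby REDUCED, per pair, to the one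
inequality `v_p(coeff₁ ξ_η) ≥ v_p(coeff₁ L_p⁺(V,η,T))`. CONDITIONAL on the displayed inputs; `halg` is
OPEN on every rank-one census row; asserts nothing class-wide; closes nothing. [cite: Kobayashi2003, Thm. 1.2 and Thm. 1.3 (p. 2), Thm. 2.2 (p. 5), Thm. 4.1 and §4 (p. 8), (3.4)/(3.6) (p. 7)]
[cite: GreenbergLNM1716, §1 p. 65 and §3 Lemma 3.1] [cite: Washington1997, §13.2] -/
theorem quadraticBranchPlusEtaMainConjectureAt_of_namedFacts_of_certV_of_coeffDvd
    (h12 : Kobayashi2003.thm12_signedSelmerDual_finite_torsion)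
    (h13 : Kobayashi2003.thm41_signedCharIdeal_divisibility)
    (h22 : Kobayashi2003.thm22_etaSignedSelmerDual_finite_torsion)
    (h41 : Kobayashi2003.thm41_plusEtaCharIdeal_dvd)
    (hp5 : 5 ≤ p) (hgood : V.HasGoodReductionAtPrime p) (hap : V.frobeniusTrace p = 0)
    (hsurj : ∀ m : ℕ, V.HasSurjectiveModNGaloisRep (p ^ m : ℕ))
    (hcertV : ∀ {N : ℕ} [NeZero N] (f : CuspForm (Gamma0 N) 2), IsNewformOf V f →
      ∃ L : IwasawaAlgebra p, Kobayashi2003.IsSignedPAdicLFunction f p 1 L ∧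
        IsUnit (PowerSeries.coeff V.mordellWeilRank L))
    (v : ℕ)
    (han : ∀ {N : ℕ} [NeZero N] {f : CuspForm (Gamma0 N) 2}, IsNewformOf V f →
      ∀ (ϖ : ℚ), (if Even (p / 2) then (ϖ : ℝ) * V.realPeriodRat = plusPeriod f
          else (ϖ : ℝ) * V.imaginaryPeriodRat = minusPeriod f) →
      ∀ (Lη : IwasawaAlgebra p), IsQuadraticBranchPlusLFunction f p ϖ Lη →
        ¬ (p : ℤ_[p]) ^ (v + 1) ∣
          PowerSeries.coeff (V.quadraticTwist ((-1) ^ (p / 2) * p)).mordellWeilRank Lη)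
    (halg : ∀ (K₀ : Type) [Field K₀] [NumberField K₀] [IsCyclotomicExtension {p} ℚ K₀]
      [(galRange (K := ℚ) K₀).Normal] (ηq : absoluteGaloisGroup ℚ →* ℤˣ),
      (∀ σ ∈ galRange (K := ℚ) K₀, ηq σ = 1) → ηq ≠ 1 →
      ∀ (κ : ZpExtension ℚ p) (γ : absoluteGaloisGroup ℚ),
        κ.IsCyclotomic → κ.IsTopGenerator γ → γ ∈ galRange (K := ℚ) K₀ → IsCyclotomicVariable p γ →
      ∀ (D : EtaSignedSelmerDualData V κ K₀ ℚ_[p] ηq γ 1) (g : IwasawaAlgebra p),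
        D.charIdeal = Ideal.span {g} →
        (p : ℤ_[p]) ^ v ∣ PowerSeries.coeff (V.quadraticTwist ((-1) ^ (p / 2) * p)).mordellWeilRank g) :
    QuadraticBranchPlusEtaMainConjectureAt V p := by
  intro K₀ _ _ _ _ ηq hηK hη1 N _ f hp2 hgood' hap' hf ϖ hϖ Lη hL κ γ hκ hγ hγK hγc D
  -- Thm. 2.2 at `η`: `D.X` is finitely generated torsion; a characteristic power series `g`
  obtain ⟨hfin, htor⟩ :=
    EtaSignedSelmerDualData.finite_isTorsion_of_thm22 h22 hηK hp2 hgood' hap' hκ hγ hγK D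
  haveI : Module.Finite (IwasawaAlgebra p) D.X := hfin
  obtain ⟨g, hg⟩ := (charIdeal_isPrincipal_holds p D.X).principal
  have hg' : D.charIdeal = Ideal.span {g} := hg
  -- the Kato side (Thm. 4.1 at `η`, `n = 0` on the tower-onto locus): `g ∣ Lη`
  obtain ⟨-, hup⟩ := EtaSignedSelmerDualData.thm41_plus_of_facts h22 h41 hηK hη1 hp2 hgood' hap' hf
    ϖ hϖ Lη hL hκ hγ hγK hγc D
  have hgL : g ∣ Lη := by
    have h := hup hsurj
    rw [hg', Ideal.span_singleton_le_span_singleton] at h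
    exact h
  -- the `η`-rank bound (§2): `T^r ∣ g`
  have hXg := X_pow_twistRank_dvd_etaCharGenerator_of_namedFacts_of_certV h12 h13 h22 hp5 hgood hap
    hsurj (fun f hf => hcertV f hf) hf K₀ ηq hηK hη1 κ γ hκ hγ hγK hγc D hg'
  -- squeeze (§1)
  have heq : Ideal.span {g} = Ideal.span {Lη} :=
    span_singleton_eq_of_X_pow_dvd_of_dvd_of_pow_dvd_coeff hXg hgL
      (halg K₀ ηq hηK hη1 κ γ hκ hγ hγK hγc D g hg') (han hf ϖ hϖ Lη hL)
  exact ⟨hfin, htor, hg'.trans heq⟩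

/-- **(E⁺_η) — the content of crux 19601 — AT A TOWER-ONTO PAIR OF ANY RANK from the valuation
squeeze** (the lower half of the previous theorem, `quadraticBranchPlusEtaLowerInclusionAt_of_plusEtaMainConjectureAt`).
CONDITIONAL; `halg` OPEN on the rank-one rows; asserts nothing class-wide; closes nothing.
[cite: Kobayashi2003, Thm. 2.2 (p. 5), Thm. 4.1 and §4 (p. 8)] -/
theorem quadraticBranchPlusEtaLowerInclusionAt_of_namedFacts_of_certV_of_coeffDvd
    (h12 : Kobayashi2003.thm12_signedSelmerDual_finite_torsion)
    (h13 : Kobayashi2003.thm41_signedCharIdeal_divisibility)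
    (h22 : Kobayashi2003.thm22_etaSignedSelmerDual_finite_torsion)
    (h41 : Kobayashi2003.thm41_plusEtaCharIdeal_dvd)
    (hp5 : 5 ≤ p) (hgood : V.HasGoodReductionAtPrime p) (hap : V.frobeniusTrace p = 0)
    (hsurj : ∀ m : ℕ, V.HasSurjectiveModNGaloisRep (p ^ m : ℕ))
    (hcertV : ∀ {N : ℕ} [NeZero N] (f : CuspForm (Gamma0 N) 2), IsNewformOf V f →
      ∃ L : IwasawaAlgebra p, Kobayashi2003.IsSignedPAdicLFunction f p 1 L ∧
        IsUnit (PowerSeries.coeff V.mordellWeilRank L))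
    (v : ℕ)
    (han : ∀ {N : ℕ} [NeZero N] {f : CuspForm (Gamma0 N) 2}, IsNewformOf V f →
      ∀ (ϖ : ℚ), (if Even (p / 2) then (ϖ : ℝ) * V.realPeriodRat = plusPeriod f
          else (ϖ : ℝ) * V.imaginaryPeriodRat = minusPeriod f) →
      ∀ (Lη : IwasawaAlgebra p), IsQuadraticBranchPlusLFunction f p ϖ Lη →
        ¬ (p : ℤ_[p]) ^ (v + 1) ∣
          PowerSeries.coeff (V.quadraticTwist ((-1) ^ (p / 2) * p)).mordellWeilRank Lη)
    (halg : ∀ (K₀ : Type) [Field K₀] [NumberField K₀] [IsCyclotomicExtension {p} ℚ K₀]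
      [(galRange (K := ℚ) K₀).Normal] (ηq : absoluteGaloisGroup ℚ →* ℤˣ),
      (∀ σ ∈ galRange (K := ℚ) K₀, ηq σ = 1) → ηq ≠ 1 →
      ∀ (κ : ZpExtension ℚ p) (γ : absoluteGaloisGroup ℚ),
        κ.IsCyclotomic → κ.IsTopGenerator γ → γ ∈ galRange (K := ℚ) K₀ → IsCyclotomicVariable p γ →
      ∀ (D : EtaSignedSelmerDualData V κ K₀ ℚ_[p] ηq γ 1) (g : IwasawaAlgebra p),
        D.charIdeal = Ideal.span {g} →
        (p : ℤ_[p]) ^ v ∣ PowerSeries.coeff (V.quadraticTwist ((-1) ^ (p / 2) * p)).mordellWeilRank g) :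
    QuadraticBranchPlusEtaLowerInclusionAt V p :=
  quadraticBranchPlusEtaLowerInclusionAt_of_plusEtaMainConjectureAt
    (quadraticBranchPlusEtaMainConjectureAt_of_namedFacts_of_certV_of_coeffDvd h12 h13 h22 h41 hp5 hgood
      hap hsurj hcertV v han halg)

end Pair

end Summit.BirchSwinnertonDyer.BirchSwinnertonDyer.Theorems

end
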